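import Summits.HodgeConjecture.HodgeConjecture.Theses.HeckePrymWeil
import Literature.AlgebraicGeometry.Motives.AbelianVarietyProduct
import Literature.AlgebraicGeometry.Motives.AbelianVarietyProductDimProofs
import Literature.AlgebraicGeometry.Motives.HyperbolicWeilType
import Literature.AlgebraicGeometry.Motives.WeilDiscriminantRealization
import Literature.AlgebraicGeometry.HodgeTheory.WeilClassesFourfoldsProofs
import Literature.NumberTheory.QuadraticForms.Meyer
import HarnessLib.Audit

/-!
# Line `hyperbolic-eightfold-descent` — skeleton for crux `HeckePrymWeil.WeilSixfoldsSqrtMinus7`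
(item stmt-HodgeConjecture-1260, route route-HodgeConjecture-HeckePrymWeil; crux-plan, planner
`planner-cruxplan-stmt-HodgeConjecture-1260-hyperbolic-eightfold-0`, 2026-08-16)

Crux (FIXED, the route's typing): on every complex abelian SIXFOLD `A` with `φ ≫ φ = -7` every
rational `(3,3)`-class in the Weil span `Eig((𝟙+φ)^*, (1+i√7)⁶) ⊔ Eig((𝟙+φ)^*, (1-i√7)⁶) ⊆ H⁶(A(ℂ); ℂ)`
is algebraic — all discriminants `det H ∈ ℚ^×/Nm(K^×)`, `K = ℚ(√-7)` (known: `det H = -1`,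
Markman2025SecantWeil Thm 1.5.1; open otherwise, WeilLocusSixfolds2026 §1).

Idea (crux idea card `Cruxes/WeilSixfoldsSqrtMinus7/Ideas/hyperbolic-eightfold-descent.md`, triage
`TRIAGE-r1-1.md`: pass, sharpen "∃ B per A, not ∀ B"): AIM THE DESCENT. The norm-residue group
`ℚ^×/Nm(K^×)` is 2-torsion and `det H` is multiplicative under products (Schoen 1998 §10;
Markman2025SurveySecant §11.5 Step 2; tree: `Motives.weilDiscriminant_bilinOrthSum`), so for a
Weil sixfold `A` (`det H_A = -a`) and the CM Weil SURFACE `B = E × E`, `E = ℂ/O_K`, `K` acting by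
`(ι, ῑ)`, polarisation weights `(m₁, m₂)` (`det H_B = -m₁ m₂ r²`), the eightfold `A × B` has
`det H = a m₁ m₂ r² ≡ 1 = (-1)⁴` for the right weights: it is HYPERBOLIC (Witt index 4), whatever
the discriminant of `A` was.  Schoen's descent `pr_{A*}(z · (A × D))` then returns the Weil classes of
`A` from those of `A × B`.  Hence the crux for ALL discriminants follows from Weil-class algebraicity
on ONE component one dimension up — the hyperbolic `ℚ(√-7)`-eightfolds — which (unlike the
non-hyperbolic sixfold components: no secant presentation, no non-degenerate cover family, census
`CensusIdeateR1K1.md` B1/B3) carries anchors: Markman's genus-4 secant sheaves on `J(C₄) × Ĵ(C₄)`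
(Markman2025SecantWeil Ex. 8.2.3/8.2.5, semiregularity = his OPEN Question 8.2.4) and the
`SL₂(𝔽₇)` half-principal-series Hecke–Prym eightfolds (card; triage GAP j007508).

The five registered stubs (signatures over existing Literature / Mathlib declarations only; no
local definitions; the Weil span is always spelled in the ROUTE's single-operator typing):

* `stub_hyperbolicEightfolds` — C⁺, the transferred crux (HARDEST, load-bearing): rational
  `(4,4)` Weil classes are algebraic on every `ℚ(√-7)`-Weil EIGHTFOLD `(X, ψ)` carrying a
  `ψ`-compatible divisor class `h` (rational, in `N¹H²`, `ψ^* h = 7h`, `Q_h = h⁷ ⌣ · ⌣ ·`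
  non-degenerate on `H¹`) for which `(X, ψ, h)` is of HYPERBOLIC Weil type
  (`Motives.IsHyperbolicWeilType X ψ 4 h`: a `K`-stable rational `Q_h`-Lagrangian `8`-frame of
  `H¹`, van Geemen 5.2/5.4 = `det H = (-1)⁴`).  Size XL / open (Markman Q 8.2.4 at `d = 7`).
* `stub_aimingArithmetic` — the lever `δ² = 1` as pure algebra over `K = ℚ(α)`, `α² = -7`
  (Landherr for our purpose, from Meyer's theorem `NumberTheory.QuadraticForms.meyer_holds`,
  PROVED in the tree): a Weil-type alternating form `E` of signature `(n, n)` on a `2n`-dimensional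
  `K`-space becomes HYPERBOLIC (an `α`-stable… i.e. `K`-subspace of dimension `n + 1`, totally
  isotropic) after adding the binary form `Im⟨m₁ r₁, -m₂ r₂⟩` (`Motives.diagWeilForm`,
  `Motives.bilinOrthSum`) for suitable positive integers `m₁, m₂` — for ANY prescribed
  `r₁, r₂ > 0`.  Size M (provable now).
* `stub_hyperbolicPartner` — the aiming lemma on the real carriers, GIVEN the arithmetic: for a
  Weil-type `ℚ(√-7)` sixfold `(A, φ)` (witnessed by a non-zero rational `(3,3)` Weil class) there
  is a Weil surface `(B, φ_B)` (intended: `E_{√-7} × E_{√-7}` with `K`-action `(ι, ῑ)`, the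
  reviewers' `E' = E` repair of `WeilDescending`) carrying a DESCENT PAIR (`b± ∈ Eig((𝟙+φ_B)^*,
  (1±i√7)²)`, `b₊ + b₋` rational `(1,1)`, an algebraic `η ∈ N¹H²(B)` with `b± ⌣ η ≠ 0`: Schoen's
  "`ω₅,₁∧ω₆,₁∧ω₅,₂∧ω₆,₂` is a basis of `H⁴(A')`") and a `ψ`-compatible divisor class `h` on
  `A × B`, `ψ = φ × φ_B`, with `(A × B, ψ, h)` hyperbolic.  Size XL in Lean (CM curve as
  `AbelianVariety ℂ` with `ι`; `H¹` eigen-bookkeeping; realisation dictionary `H* = ⋀*H¹`,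
  `Q_h ∝ E^*` of `Motives/HyperbolicWeilType`; van Geemen 5.2 (1)); classically one page.
* `stub_hodgeTypeExterior` — Hodge types are compatible with exterior products on `A × B`
  (Künneth for Hodge models: `pr_A^* c ⌣ pr_B^* w` is of type `(p+p', q+q')`; Voisin I §11.3,
  Thm 11.38).  The layer's hypothesis predicates `PreservesHodgeType` / `CupPreservesHodgeType`
  made a theorem for products of abelian varieties.  Size L (infrastructure).
* `stub_descent` — Schoen's descent `8 → 6` for ONE partner surface with a descent pair, GIVEN the
  Hodge bookkeeping, unconditional otherwise (the tree's `4 ← 6` versions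
  `WeilClassesFourfoldsStep2.…pointwise_of_sixfold_partner`,
  `WeilClassesFourfoldsProofs.weilClassesOf_le_algebraicClasses_of_prod` are relative to a
  `GysinFormalism` parameter and to the hypotheses (V) cup-multiplicativity, (H) Hodge predicates,
  (P) non-vanishing; here the prover discharges them: real Gysin `complexGysin` + Poincaré duality,
  moving the divisor `η` by translations on `B`, the rational Weil projector `q(T)`,
  `T = (𝟙 + ψ)^*`, of `WeilClassesProducts`).  Size L.

`WeilSixfoldsSqrtMinus7_of` takes the five statements as hypotheses (`type_of% stub_…`, so it is a
closed, sorry-free theorem) and concludes the crux BY NAME; `WeilSixfoldsSqrtMinus7_of_stubs` feeds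
it the stubs.  Glue proved inside `_of`: the case `c = 0`; `(A × B).dim = 8` (`dim_prod`);
`(φ × φ_B)² = -7` (`prodLift_comp_self_eq_neg_nsmul`, `ℕ`- vs `ℤ`-scalar `7`).

Disproof used: NONE — no `Disproof.lean` exists for this crux (payload `disproof_path` absent on
the hub; `ledger crux ls stmt-HodgeConjecture-1260` lists none; TRIAGE-r1-1 concurs): no
`_false_without_` / tightness / Negative lemma to honour or avoid.  `ledger negatives
--problem HodgeConjecture`: none on Weil classes.  Dead lines (census B1–B4): the product
`A × B_δ` is the TARGET of a descent, not an anchor to deform from (B4); hyperbolicity is bought,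
not fought (B1/B3).
-/

noncomputable section

open CategoryTheory
open Literature.AlgebraicGeometry Literature.AlgebraicGeometry.Motives
  Literature.AlgebraicGeometry.HodgeTheory Literature.AlgebraicTopology.SingularHomology

namespace Summit.HodgeConjecture.HodgeConjecture.Cruxes.WeilSixfoldsSqrtMinus7.HyperbolicEightfoldDescent

/-! ### The five registered stubs -/

/-- **Stub 1 — C⁺, Weil classes on HYPERBOLIC `ℚ(√-7)`-Weil eightfolds (hardest; the transferred
crux).** For a complex abelian eightfold `X` with `ψ ≫ ψ = -7` and a class `h ∈ H²(X(ℂ); ℂ)` which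
is rational, supported on a divisor (`h ∈ N¹H²`), `ψ`-compatible (`ψ^* h = 7 h`, i.e.
`E(√-7 x, √-7 y) = 7 E(x, y)`), whose polarisation pairing `Q_h(x, y) = h⁷ ⌣ (x ⌣ y)` is
non-degenerate on `H¹(X(ℂ); ℂ)`, and for which `(X, ψ, h)` is of hyperbolic Weil type (a
`ψ^*`-stable rational `Q_h`-Lagrangian `8`-frame in `H¹`; van Geemen 5.2 (2)–(3), 5.4: Witt index
`4`, `det H = (-1)⁴ ∈ ℚ^×/Nm(K^×)`): every rational `(4,4)`-class of the Weil span
`Eig((𝟙+ψ)^*, (1+i√7)⁸) ⊔ Eig((𝟙+ψ)^*, (1-i√7)⁸) ⊆ H⁸(X(ℂ); ℂ)` is algebraic.  Off Weil type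
`(4,4)` the Hodge hypothesis makes it vacuous; on a hyperbolic POLARISED component it is Markman's
programme one genus up (anchors `J(C₄) × Ĵ(C₄)`, Markman2025SecantWeil Ex. 8.2.3/8.2.5 and
κ-invariance; missing: semiregularity, his Question 8.2.4) or the `SL₂(𝔽₇)` Hecke–Prym rung + transport.
[informal size XL; open] -/
theorem stub_hyperbolicEightfolds :
    ∀ (X : AbelianVariety ℂ) (ψ : X ⟶ X), X.dim = 8 → ψ ≫ ψ = -((7 : ℤ) • 𝟙 X) →
    ∀ h : complexBetti X.X 2, IsRationalClass h → h ∈ algebraicClasses X.X 1 →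
      complexBetti.map ψ.hom.hom.hom 2 h = (7 : ℂ) • h →
      (∀ x : complexBetti X.X 1,
        (∀ y : complexBetti X.X 1, polarizationPairingOne X.X h 7 x y = 0) → x = 0) →
      IsHyperbolicWeilType X ψ 4 h →
    ∀ c : complexBetti X.X 8, IsRationalClass c → IsOfHodgeType 8 X.X 8 4 4 c →
      c ∈ Module.End.eigenspace (complexBetti.map (𝟙 X + ψ).hom.hom.hom 8).hom
            ((1 + Complex.I * (Real.sqrt (7 : ℝ) : ℂ)) ^ 8) ⊔
          Module.End.eigenspace (complexBetti.map (𝟙 X + ψ).hom.hom.hom 8).hom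
            ((1 - Complex.I * (Real.sqrt (7 : ℝ) : ℂ)) ^ 8) →
      c ∈ algebraicClasses X.X 4 := by
  sorry

/-- **Stub 2 — the lever `δ² = 1`, as arithmetic of Hermitian forms over `K = ℚ(√-7)`
(Landherr for our purpose; provable now from Meyer's theorem, `meyer_holds`).** Let `K ∋ α`,
`α² = -7`, `K = ℚ + ℚ α`; `V` a `K`-space of dimension `2n`; `E` an alternating `ℚ`-bilinear form
on `V` of Weil type (`E(α x, α y) = 7 E(x, y)`) whose Hermitian form `H(x, y) = E(x, α y) + α E(x, y)`
(van Geemen 5.2 (2); `H(x, x) = E(x, α x) ∈ ℚ`) has SIGNATURE `(n, n)`: `V = P ⊕ N` with `H`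
positive definite on `P`, negative definite on `N`, `dim_K P = dim_K N = n`.  Then for all rationals
`r₁, r₂` of the same sign (`r₁ r₂ > 0`; both sign patterns of the CM surface's two factors) there are
positive integers `m₁, m₂` such that the orthogonal sum of `E` and the binary Weil form
`Im⟨m₁ r₁, -m₂ r₂⟩` on `K²` (`diagWeilForm`, Gram matrix `diag(m₁ r₁, -m₂ r₂)`, signature `(1,1)`) is
HYPERBOLIC: `V × K²` contains a `K`-subspace of dimension `n + 1` on which the summed form vanishes
identically (`E|_L = 0 ⟺ H|_L = 0` on `K`-subspaces, `Motives.forall_weilHermitianForm_eq_zero_iff`).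
Proof sketch: `det H = (-1)ⁿ a`, `a > 0`; choose `m₁ = 1`, `m₂` with `a m₂ r₁ r₂ ∈ (ℚ^×)²`; an
indefinite Hermitian form of rank `≥ 3` over `K` is isotropic because its trace form is an
indefinite rational quadratic form of rank `≥ 6` (Meyer, Serre1973 IV §3.2 Cor. 2), so by induction
`H ⊕ ⟨r₁, -m₂ r₂⟩ ≅ Hypⁿ ⊕ ⟨x, -y⟩` with `xy ∈ Nm(K^×)`, and `⟨x, -y⟩` is then a hyperbolic plane
(Deligne1982HodgeCycles Cor. 4.2; van Geemen 5.4 (5.4.1)). [informal size M] -/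
theorem stub_aimingArithmetic :
    ∀ (K : Type) [Field K] [Algebra ℚ K] (α : K) (hα : α * α = algebraMap ℚ K (-7))
      (hK : ∀ k : K, ∃ a b : ℚ, k = algebraMap ℚ K a + algebraMap ℚ K b * α)
      (V : Type) [AddCommGroup V] [Module ℚ V] [Module K V] [IsScalarTower ℚ K V]
      [Module.Finite K V] (n : ℕ), Module.finrank K V = 2 * n →
    ∀ (E : LinearMap.BilinForm ℚ V), (∀ x y : V, E x y = -E y x) →
      (∀ x y : V, E (α • x) (α • y) = 7 * E x y) →
      (∃ P N : Submodule K V, Module.finrank K P = n ∧ Module.finrank K N = n ∧ P ⊓ N = ⊥ ∧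
        (∀ x ∈ P, x ≠ 0 → 0 < E x (α • x)) ∧ (∀ x ∈ N, x ≠ 0 → E x (α • x) < 0)) →
    ∀ r₁ r₂ : ℚ, 0 < r₁ * r₂ →
      ∃ m₁ m₂ : ℕ, 0 < m₁ ∧ 0 < m₂ ∧
        ∃ L : Submodule K (V × (Fin 2 → K)), Module.finrank K L = n + 1 ∧
          ∀ x ∈ L, ∀ y ∈ L,
            bilinOrthSum E
              (diagWeilForm (d := 7) (by norm_num) hα hK (Pi.basisFun K (Fin 2))
                ![(m₁ : ℚ) * r₁, -((m₂ : ℚ) * r₂)]) x y = 0 := by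
  sorry

/-- **Stub 3 — the hyperbolic partner (aiming lemma on the real carriers), GIVEN Stub 2.** For a
complex abelian sixfold `(A, φ)`, `φ ≫ φ = -7`, which is of Weil type — witnessed, as the crux
supplies it, by a NON-ZERO rational `(3,3)`-class in its Weil span — there exist a complex abelian
SURFACE `B` with `φ_B ≫ φ_B = -7` carrying a DESCENT PAIR: eigenclasses
`b₊ ∈ Eig((𝟙+φ_B)^*, (1+i√7)²)`, `b₋ ∈ Eig((𝟙+φ_B)^*, (1-i√7)²)` in `H²(B(ℂ); ℂ)` with `b₊ + b₋`
rational of type `(1,1)`, and an algebraic class `η ∈ N¹H²(B(ℂ); ℂ)` with `b₊ ⌣ η ≠ 0`,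
`b₋ ⌣ η ≠ 0` in `H⁴(B(ℂ); ℂ)` (Schoen 1998 §10: `W_{A'} ⊗ ℂ = ⟨ω₅,σ∧ω₆,σ⟩_σ` is of type `(1,1)`,
generated by divisor classes, and `ω₅,₁∧ω₆,₁∧ω₅,₂∧ω₆,₂` is a basis of `H⁴(A')`), AND a class
`h ∈ H²((A × B)(ℂ); ℂ)` — rational, supported on a divisor, compatible with `ψ = φ × φ_B`
(`ψ^* h = 7 h`), with `Q_h` non-degenerate on `H¹` — for which `(A × B, ψ, h)` is of HYPERBOLIC Weil
type.  Intended witness (one `B` serves every `A`): `B = E × E`, `E = ℂ/ℤ[(1+√-7)/2]` (the CM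
elliptic curve `y² + xy = x³ - x² - 2x - 1`), `φ_B = (ι, -ι)` with `ι = [√-7]`, so `B` is of Weil
type `(1,1)`; `h = pr_A^* h_A + pr_B^*(m₁ pr₁^* h_E + m₂ pr₂^* h_E)` with `h_A` a `K`-compatible
polarisation class of `A` (exists: van Geemen 5.2 (1), averaging `E + φ^*E/7`) and `(m₁, m₂)` from
Stub 2 applied to `(H₁(A, ℚ), E_A)` (signature `(3,3)` = Weil type) with `r₁ = r₂ = r`, through the
dictionary of `Motives/HyperbolicWeilType` (module docstring (1)–(4): `H*(X) = ⋀*H¹`,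
`Q_h = c · E^* · vol`, `H|_W = 0 ⟺ E|_W = 0`, `H_{A×B} = H_A ⊕ t·H_B`, `t ∈ ℚ_{>0}`).
[informal size: classically one page; Lean XL — CM curve with `ι` as an `AbelianVariety ℂ`
endomorphism, `H¹(E(ℂ))` eigen-bookkeeping, Künneth for `H¹` of a product, divisor classes on
carriers] -/
theorem stub_hyperbolicPartner :
    (type_of% stub_aimingArithmetic) →
    ∀ (A : AbelianVariety ℂ) (φ : A ⟶ A), A.dim = 6 → φ ≫ φ = -((7 : ℤ) • 𝟙 A) →
    (∃ c : complexBetti A.X 6, c ≠ 0 ∧ IsRationalClass c ∧ IsOfHodgeType 6 A.X 6 3 3 c ∧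
      c ∈ Module.End.eigenspace (complexBetti.map (𝟙 A + φ).hom.hom.hom 6).hom
            ((1 + Complex.I * (Real.sqrt (7 : ℝ) : ℂ)) ^ 6) ⊔
          Module.End.eigenspace (complexBetti.map (𝟙 A + φ).hom.hom.hom 6).hom
            ((1 - Complex.I * (Real.sqrt (7 : ℝ) : ℂ)) ^ 6)) →
    ∃ (B : AbelianVariety ℂ) (φB : B ⟶ B), B.dim = 2 ∧ φB ≫ φB = -((7 : ℤ) • 𝟙 B) ∧
      (∃ bp bm η : complexBetti B.X 2,
        bp ∈ Module.End.eigenspace (complexBetti.map (𝟙 B + φB).hom.hom.hom 2).hom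
              ((1 + Complex.I * (Real.sqrt (7 : ℝ) : ℂ)) ^ 2) ∧
        bm ∈ Module.End.eigenspace (complexBetti.map (𝟙 B + φB).hom.hom.hom 2).hom
              ((1 - Complex.I * (Real.sqrt (7 : ℝ) : ℂ)) ^ 2) ∧
        IsRationalClass (bp + bm) ∧ IsOfHodgeType 2 B.X 2 1 1 (bp + bm) ∧
        η ∈ algebraicClasses B.X 1 ∧
        cupProduct (show 2 + 2 = 4 from rfl) bp η ≠ 0 ∧
        cupProduct (show 2 + 2 = 4 from rfl) bm η ≠ 0) ∧
      ∃ h : complexBetti (A.prod B).X 2,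
        IsRationalClass h ∧ h ∈ algebraicClasses (A.prod B).X 1 ∧
        complexBetti.map (AbelianVariety.prodLift (AbelianVariety.fst A B ≫ φ)
            (AbelianVariety.snd A B ≫ φB)).hom.hom.hom 2 h = (7 : ℂ) • h ∧
        (∀ x : complexBetti (A.prod B).X 1,
          (∀ y : complexBetti (A.prod B).X 1,
            polarizationPairingOne (A.prod B).X h 7 x y = 0) → x = 0) ∧
        IsHyperbolicWeilType (A.prod B) (AbelianVariety.prodLift (AbelianVariety.fst A B ≫ φ)
            (AbelianVariety.snd A B ≫ φB)) 4 h := by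
  sorry

/-- **Stub 4 — Hodge types of exterior products (Künneth for Hodge models).** For complex
abelian varieties `A`, `B` of dimensions `a`, `b` and classes `c ∈ Hᵏ(A(ℂ); ℂ)` of type `(p, q)`,
`w ∈ Hˡ(B(ℂ); ℂ)` of type `(p', q')` (in the tree's sense `IsOfHodgeType`: for SOME Hodge model),
the exterior product `pr_A^* c ⌣ pr_B^* w ∈ H^{k+l}((A × B)(ℂ); ℂ)` is of type `(p + p', q + q')`
for the dimension parameter `a + b` (Voisin I, §11.3.2 / Thm 11.38: the Künneth isomorphism is an
isomorphism of Hodge structures and the cup product is a morphism of Hodge structures; on Hodge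
models: the product manifold `A^an × B^an` with the product Kähler metric, wedge of harmonic
forms).  This turns the layer's hypothesis predicates `PreservesHodgeType` (for `pr_A^*`, `pr_B^*`)
and `CupPreservesHodgeType` into a theorem for products of abelian varieties. [informal size L] -/
theorem stub_hodgeTypeExterior :
    ∀ (A B : AbelianVariety ℂ) (a b : ℕ), A.dim = a → B.dim = b →
    ∀ (k l m : ℕ) (hklm : k + l = m) (p q p' q' : ℕ)
      (c : complexBetti A.X k) (w : complexBetti B.X l),
      IsOfHodgeType a A.X k p q c → IsOfHodgeType b B.X l p' q' w →
      IsOfHodgeType (a + b) (A.prod B).X m (p + p') (q + q')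
        (cupProduct hklm (complexBetti.map (AbelianVariety.fst A B).hom.hom.hom k c)
          (complexBetti.map (AbelianVariety.snd A B).hom.hom.hom l w)) := by
  sorry

/-- **Stub 5 — Schoen's descent `8 → 6` for ONE partner surface, GIVEN Stub 4.** Let `(A, φ)` be
a complex abelian sixfold and `(B, φ_B)` a complex abelian surface, `φ² = φ_B² = -7`, `B` carrying a
descent pair `(b₊, b₋, η)` as in Stub 3, and `ψ = φ × φ_B` on `A × B`.  IF every rational
`(4,4)`-class in the Weil span `Eig((𝟙+ψ)^*, (1+i√7)⁸) ⊔ Eig((𝟙+ψ)^*, (1-i√7)⁸)` of `A × B` is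
algebraic, THEN every rational `(3,3)`-class `c = c₊ + c₋` in the Weil span of `A` is algebraic.
Proof (Schoen1998HodgeWeilAddendum §10; Markman2025SurveySecant §11.5 Step 2; the tree's
`WeilClassesProducts` / `WeilClassesFourfoldsProofs` patterns one dimension up): `P = pr_A^* c ⌣
pr_B^*(b₊ + b₋)` is rational (`isRationalClass_cupProduct_map_fst_map_snd`) and `(4,4)` (Stub 4);
with `T = (𝟙 + ψ)^*` (`(𝟙+ψ) ≫ pr_A = pr_A ≫ (𝟙+φ)`) its four pieces have eigenvalues
`λ₊⁸, λ₋⁸, λ₊⁶λ₋², λ₋⁶λ₊²` (`λ± = 1 ± i√7`; pairwise distinct since `λ₊/λ₋` is no root of unity),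
so `Q = q(T)P`, `TQ` (`q(X) = (X - λ₊⁶λ₋²)(X - λ₋⁶λ₊²) ∈ ℤ[X]`: `β + β̄ = 1024`, `ββ̄ = 8⁸`) are
rational `(4,4)` Weil classes of `A × B`, hence algebraic, hence so are `P₊₊ = pr_A^*c₊ ⌣ pr_B^*b₊`
and `P₋₋` (`mem_and_mem_of_smul_add_smul_mem`); `P±± ⌣ pr_B^* η ∈ N⁵H¹⁰` (cup with the flat
pull-back of a divisor class, after moving the divisor by a translation of `B` off the projections
of the support — translations act trivially on `H*(B(ℂ))`); and `pr_{A*}(P±± ⌣ pr_B^* η) =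
c± ⌣ pr_{A*}pr_B^*(b± ⌣ η) = ε± · c±` with `ε± ≠ 0` because `b± ⌣ η ≠ 0` spans `H⁴(B(ℂ); ℂ) ≅ ℂ`
(real Gysin `complexGysin` + Poincaré duality, projection formula `complexGysin_cup`, Gysin maps
preserve `N^•`: `gysinMap_mem_supportedClasses_of_isSmoothProjective`), so `c±`, hence `c`, are
algebraic. [informal size L] -/
theorem stub_descent :
    (type_of% stub_hodgeTypeExterior) →
    ∀ (A : AbelianVariety ℂ) (φ : A ⟶ A) (B : AbelianVariety ℂ) (φB : B ⟶ B),
      A.dim = 6 → B.dim = 2 → φ ≫ φ = -((7 : ℤ) • 𝟙 A) → φB ≫ φB = -((7 : ℤ) • 𝟙 B) →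
      (∃ bp bm η : complexBetti B.X 2,
        bp ∈ Module.End.eigenspace (complexBetti.map (𝟙 B + φB).hom.hom.hom 2).hom
              ((1 + Complex.I * (Real.sqrt (7 : ℝ) : ℂ)) ^ 2) ∧
        bm ∈ Module.End.eigenspace (complexBetti.map (𝟙 B + φB).hom.hom.hom 2).hom
              ((1 - Complex.I * (Real.sqrt (7 : ℝ) : ℂ)) ^ 2) ∧
        IsRationalClass (bp + bm) ∧ IsOfHodgeType 2 B.X 2 1 1 (bp + bm) ∧
        η ∈ algebraicClasses B.X 1 ∧
        cupProduct (show 2 + 2 = 4 from rfl) bp η ≠ 0 ∧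
        cupProduct (show 2 + 2 = 4 from rfl) bm η ≠ 0) →
      (∀ u : complexBetti (A.prod B).X 8, IsRationalClass u → IsOfHodgeType 8 (A.prod B).X 8 4 4 u →
        u ∈ Module.End.eigenspace (complexBetti.map (𝟙 (A.prod B) +
                AbelianVariety.prodLift (AbelianVariety.fst A B ≫ φ)
                  (AbelianVariety.snd A B ≫ φB)).hom.hom.hom 8).hom
              ((1 + Complex.I * (Real.sqrt (7 : ℝ) : ℂ)) ^ 8) ⊔
            Module.End.eigenspace (complexBetti.map (𝟙 (A.prod B) +
                AbelianVariety.prodLift (AbelianVariety.fst A B ≫ φ)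
                  (AbelianVariety.snd A B ≫ φB)).hom.hom.hom 8).hom
              ((1 - Complex.I * (Real.sqrt (7 : ℝ) : ℂ)) ^ 8) →
        u ∈ algebraicClasses (A.prod B).X 4) →
      ∀ c : complexBetti A.X 6, IsRationalClass c → IsOfHodgeType 6 A.X 6 3 3 c →
        c ∈ Module.End.eigenspace (complexBetti.map (𝟙 A + φ).hom.hom.hom 6).hom
              ((1 + Complex.I * (Real.sqrt (7 : ℝ) : ℂ)) ^ 6) ⊔
            Module.End.eigenspace (complexBetti.map (𝟙 A + φ).hom.hom.hom 6).hom
              ((1 - Complex.I * (Real.sqrt (7 : ℝ) : ℂ)) ^ 6) →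
        c ∈ algebraicClasses A.X 3 := by
  sorry

/-! ### The composition (concludes the crux BY NAME; sorry-free glue) -/

/-- **`WeilSixfoldsSqrtMinus7` from the five stubs.** Given a sixfold `(A, φ)` and a rational
`(3,3)` Weil class `c`: if `c = 0` it is algebraic; otherwise `c` witnesses Weil type, Stub 3 (fed
Stub 2) yields the partner surface `B`, its descent pair and a hyperbolic compatible divisor class
`h` on `A × B`; `A × B` has dimension `8` (`dim_prod`) and `(φ × φ_B)² = -7`
(`prodLift_comp_self_eq_neg_nsmul`), so Stub 1 makes the rational `(4,4)` Weil classes of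
`(A × B, φ × φ_B)` algebraic, and Stub 5 (fed Stub 4) descends to `c`. -/
theorem WeilSixfoldsSqrtMinus7_of
    (h₁ : type_of% stub_hyperbolicEightfolds) (h₂ : type_of% stub_aimingArithmetic)
    (h₃ : type_of% stub_hyperbolicPartner) (h₄ : type_of% stub_hodgeTypeExterior)
    (h₅ : type_of% stub_descent) :
    Summit.HodgeConjecture.HodgeConjecture.Theses.HeckePrymWeil.WeilSixfoldsSqrtMinus7 := by
  intro A φ hA hφ c hrat hH hW
  by_cases hc : c = 0
  · rw [hc]
    exact Submodule.zero_mem _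
  obtain ⟨B, φB, hB, hφB, hpair, h, hhr, hha, hhc, hhn, hhyp⟩ :=
    h₃ h₂ A φ hA hφ ⟨c, hc, hrat, hH, hW⟩
  have hdim : (A.prod B).dim = 8 := by rw [AbelianVariety.dim_prod, hA, hB]
  have hφ' : φ ≫ φ = -((7 : ℕ) • 𝟙 A) := by rw [hφ, ← natCast_zsmul]; rfl
  have hφB' : φB ≫ φB = -((7 : ℕ) • 𝟙 B) := by rw [hφB, ← natCast_zsmul]; rfl
  have hsq : AbelianVariety.prodLift (AbelianVariety.fst A B ≫ φ) (AbelianVariety.snd A B ≫ φB) ≫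
      AbelianVariety.prodLift (AbelianVariety.fst A B ≫ φ) (AbelianVariety.snd A B ≫ φB) =
        -((7 : ℤ) • 𝟙 (A.prod B)) := by
    rw [prodLift_comp_self_eq_neg_nsmul hφ' hφB', ← natCast_zsmul]; rfl
  exact h₅ h₄ A φ B φB hA hB hφ hφB hpair
    (h₁ (A.prod B) _ hdim hsq h hhr hha hhc hhn hhyp) c hrat hH hW

/-- The crux from the stubs as they stand (depends on their `sorry`s; shows the composition closes). -/
theorem WeilSixfoldsSqrtMinus7_of_stubs :
    Summit.HodgeConjecture.HodgeConjecture.Theses.HeckePrymWeil.WeilSixfoldsSqrtMinus7 :=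
  WeilSixfoldsSqrtMinus7_of stub_hyperbolicEightfolds stub_aimingArithmetic stub_hyperbolicPartner
    stub_hodgeTypeExterior stub_descent

end Summit.HodgeConjecture.HodgeConjecture.Cruxes.WeilSixfoldsSqrtMinus7.HyperbolicEightfoldDescent
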